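import Literature.AlgebraicTopology.CharacteristicClasses.WhitneyLineCase
import Literature.AlgebraicTopology.CharacteristicClasses.TopologicalChernClasses
import Mathlib.Algebra.BigOperators.NatAntidiagonal
import HarnessLib

/-!
# The Whitney sum formula `c(E₁ ⊕ E₂) = c(E₁) ⌣ c(E₂)`

D. Husemoller, *Fibre Bundles* (3rd ed. 1994), Ch. 17 §6 Thm. 6.2, by the splitting principle
(§5 Prop. 5.2: over `P(E₁)`, `q^*E₁ ≅ λ ⊕ Q` with `q^*` injective on cohomology,
`ProjectiveBundleSplittingIso.splitIso`, `ProjectiveBundleLerayHirsch.map_projMap_injective`) and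
induction on the rank of `E₁`, the inductive step being the line case
`c(L ⊕ E) = (1 + c₁(L)) c(E)` (`WhitneyLineCase`):

* isomorphisms of the tree's bundles: `Iso.pullbackDirectSum`, `Iso.directSumCongr`,
  `Iso.directSumAssoc`, `Iso.zeroDirectSum` (a rank-`0` summand);
* `totMul c d m = Σ_{i+j=m} cᵢ ⌣ dⱼ`, in the exact shape of `ChernClassTheory.chernClass_directSum`,
  its naturality and its interaction with the Whitney family (`totMul_whitneyLine`);
* **`chernClassR_directSum`: `c_m(E₁ ⊕ E₂) = Σ_{i+j=m} cᵢ(E₁) ⌣ cⱼ(E₂)`** over any commutative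
  ring `R`, for bundles over a paracompact Hausdorff base.

Everything is proved; no named facts.

## References

* D. Husemoller, *Fibre Bundles*, GTM 20, Springer 1994, Ch. 17 §5 Prop. 5.2, §6 Thm. 6.2. [HusemollerFibreBundles1994]
-/

noncomputable section

open CategoryTheory Function Set Bundle Module Filter Finset Literature.AlgebraicTopology.SingularHomology
  Literature.AlgebraicTopology.SingularHomology.LerayHirsch
open scoped LinearAlgebra.Projectivization Topology

namespace Literature.AlgebraicTopology.CharacteristicClasses

open ComplexVectorBundle

/-! ### Total classes: `Σ_{i+j=m} cᵢ ⌣ dⱼ` -/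

section TotMul

variable {R : Type} [CommRing R] {X : Type} [TopologicalSpace X]

/-- **`(c ⋆ d)_m = Σ_{i+j=m} cᵢ ⌣ dⱼ`**, in the shape of `ChernClassTheory.chernClass_directSum`. [cite: HusemollerFibreBundles1994, Ch. 17 §3 (C₂)] -/
def totMul (c d : (i : ℕ) → singularCohomology R R X (2 * i)) (m : ℕ) : singularCohomology R R X (2 * m) :=
  ∑ ij : Finset.antidiagonal m, cupEven (Finset.mem_antidiagonal.mp ij.2) (c ij.1.1) (d ij.1.2)

/-- The summand as a total function of the index pair. [folklore] -/
def totMulF (c d : (i : ℕ) → singularCohomology R R X (2 * i)) (m : ℕ) (ij : ℕ × ℕ) : singularCohomology R R X (2 * m) :=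
  if h : ij.1 + ij.2 = m then cupEven h (c ij.1) (d ij.2) else 0

/-- `totMul` as a sum over the finset. [folklore] -/
theorem totMul_eq (c d : (i : ℕ) → singularCohomology R R X (2 * i)) (m : ℕ) :
    totMul c d m = ∑ ij ∈ Finset.antidiagonal m, totMulF c d m ij := by
  rw [totMul, ← Finset.sum_coe_sort (Finset.antidiagonal m)]
  refine Finset.sum_congr rfl fun ij _ ↦ ?_
  rw [totMulF, dif_pos]

/-- **Naturality: `f^*(c ⋆ d) = f^*c ⋆ f^*d`.** [cite: HatcherAT2002, Prop. 3.10] -/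
theorem map_totMul {Y : Type} [TopologicalSpace Y] (f : C(X, Y)) (c d : (i : ℕ) → singularCohomology R R Y (2 * i)) (m : ℕ) :
    singularCohomology.map R R f (2 * m) (totMul c d m) =
      totMul (fun i ↦ singularCohomology.map R R f (2 * i) (c i)) (fun i ↦ singularCohomology.map R R f (2 * i) (d i)) m := by
  rw [totMul, totMul, map_sum]
  exact Finset.sum_congr rfl fun ij _ ↦ cupProduct_map _ _ _ _

/-- **`(1, 0, 0, …) ⋆ d = d`.** [folklore] -/
theorem totMul_unit_left (c d : (i : ℕ) → singularCohomology R R X (2 * i)) (h0 : c 0 = singularCohomology.one R X)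
    (h : ∀ i, i ≠ 0 → c i = 0) (m : ℕ) : totMul c d m = d m := by
  rw [totMul_eq, Finset.sum_eq_single (0, m)]
  · rw [totMulF, dif_pos (Nat.zero_add m), h0]
    exact one_cupProduct _
  · rintro ⟨i, j⟩ hij hne
    rw [Finset.mem_antidiagonal] at hij
    have hi : i ≠ 0 := fun hi ↦ hne (by subst hi; simp at hij; subst hij; rfl)
    rw [totMulF, dif_pos hij, h i hi, LinearMap.map_zero₂]
  · intro h'; exact absurd (Finset.mem_antidiagonal.2 (Nat.zero_add m)) h'

/-- `(c ⋆ d)_0 = 1` when `c₀ = d₀ = 1`. [folklore] -/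
theorem totMul_zero (c d : (i : ℕ) → singularCohomology R R X (2 * i)) (hc : c 0 = singularCohomology.one R X)
    (hd : d 0 = singularCohomology.one R X) : totMul c d 0 = singularCohomology.one R X := by
  rw [totMul_eq, Finset.Nat.antidiagonal_zero, Finset.sum_singleton, totMulF, dif_pos (show ((0, 0) : ℕ × ℕ).1 + ((0, 0) : ℕ × ℕ).2 = 0 from rfl),
    hc, hd]
  exact one_cupProduct _

/-- **Left multiplication by the Whitney family: `(c' ⋆ d)_{m+1} = (c ⋆ d)_{m+1} - e ⌣ (c ⋆ d)_m`** for
`c'ᵢ = cᵢ - e ⌣ c_{i-1}` (`c₀ = 1`). [cite: HusemollerFibreBundles1994, Ch. 17 §6 Thm. 6.2 (proof)] -/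
theorem totMul_whitneyLine (e : singularCohomology R R X 2) (c d : (i : ℕ) → singularCohomology R R X (2 * i))
    (h0 : c 0 = singularCohomology.one R X) (m : ℕ) :
    totMul (whitneyLine R e c) d (m + 1) = totMul c d (m + 1) - cupProduct (show 2 + 2 * m = 2 * (m + 1) by omega) e (totMul c d m) := by
  rw [totMul_eq, totMul_eq, totMul_eq, Finset.Nat.sum_antidiagonal_succ, Finset.Nat.sum_antidiagonal_succ, map_sum]
  have e0 : totMulF (whitneyLine R e c) d (m + 1) (0, m + 1) = totMulF c d (m + 1) (0, m + 1) := by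
    rw [totMulF, totMulF, dif_pos (Nat.zero_add _), dif_pos (Nat.zero_add _)]
    change cupEven _ (whitneyLine R e c 0) _ = cupEven _ (c 0) _
    rw [whitneyLine_zero, h0]
  have es : ∀ p ∈ Finset.antidiagonal m, totMulF (whitneyLine R e c) d (m + 1) (p.1 + 1, p.2) =
      totMulF c d (m + 1) (p.1 + 1, p.2) - cupProduct (show 2 + 2 * m = 2 * (m + 1) by omega) e (totMulF c d m p) := by
    rintro ⟨i, j⟩ hp
    rw [Finset.mem_antidiagonal] at hp
    have h1 : i + 1 + j = m + 1 := by omega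
    rw [totMulF, totMulF, totMulF, dif_pos h1, dif_pos h1, dif_pos hp]
    change cupEven h1 (whitneyLine R e c (i + 1)) (d j) = cupEven h1 (c (i + 1)) (d j) - cupProduct _ e (cupEven hp (c i) (d j))
    rw [whitneyLine_succ, LinearMap.map_sub₂, cupEven, cupEven,
      cupProduct_assoc (show 2 + 2 * i = 2 * (i + 1) by omega) (two_mul_add_two_mul hp) (two_mul_add_two_mul h1)
        (show 2 + 2 * m = 2 * (m + 1) by omega)]
  rw [e0, Finset.sum_congr rfl es, Finset.sum_sub_distrib]
  abel

end TotMul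

/-! ### Isomorphisms of the tree's bundles -/

namespace ComplexVectorBundle

section Isos

variable {B : Type} [TopologicalSpace B]

/-- Continuity of a map into a pull-back total space: it suffices that its projection and its lift
be continuous. [folklore] -/
theorem continuous_to_pullback {B' : Type} [TopologicalSpace B'] (E : ComplexVectorBundle.{0, 0} B) (f : C(B', B))
    {Z : Type} [TopologicalSpace Z] (h : Z → TotalSpace (E.pullback f).F (E.pullback f).E)
    (h1 : Continuous fun z ↦ (h z).proj) (h2 : Continuous fun z ↦ @Pullback.lift B E.F E.E B' (f : B' → B) (h z)) : Continuous h :=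
  (inducing_pullbackTotalSpaceEmbedding E.F E.E (f : B' → B)).continuous_iff.2 (h1.prodMk h2)

/-- **`f^*(E₁ ⊕ E₂) ≅ f^*E₁ ⊕ f^*E₂`** (same fibres). [cite: HusemollerFibreBundles1994, Ch. 3 §3] -/
def Iso.pullbackDirectSum (E₁ E₂ : ComplexVectorBundle.{0, 0} B) {B' : Type} [TopologicalSpace B'] (f : C(B', B)) :
    ((E₁.directSum E₂).pullback f).Iso ((E₁.pullback f).directSum (E₂.pullback f)) where
  equiv x := ContinuousLinearEquiv.refl ℂ (E₁.E (f x) × E₂.E (f x))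
  continuous_toFun := by
    refine continuous_directSum_mk (E₁.pullback f) (E₂.pullback f)
      (fun p : TotalSpace ((E₁.directSum E₂).pullback f).F ((E₁.directSum E₂).pullback f).E ↦ p.proj)
      (fun p ↦ p.2.1) (fun p ↦ p.2.2) ?_ ?_
    · exact E₁.continuous_to_pullback f _ (FiberBundle.continuous_proj _ _)
        ((E₁.continuous_directSum_fst E₂).comp (Pullback.continuous_lift (E₁.directSum E₂).F (E₁.directSum E₂).E (f : B' → B)))
    · exact E₂.continuous_to_pullback f _ (FiberBundle.continuous_proj _ _)
        ((E₁.continuous_directSum_snd E₂).comp (Pullback.continuous_lift (E₁.directSum E₂).F (E₁.directSum E₂).E (f : B' → B)))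
  continuous_invFun := by
    refine (E₁.directSum E₂).continuous_to_pullback f _ (FiberBundle.continuous_proj _ _) ?_
    exact continuous_directSum_mk E₁ E₂
      (fun p : TotalSpace ((E₁.pullback f).directSum (E₂.pullback f)).F ((E₁.pullback f).directSum (E₂.pullback f)).E ↦ f p.proj)
      (fun p ↦ p.2.1) (fun p ↦ p.2.2)
      ((Pullback.continuous_lift E₁.F E₁.E (f : B' → B)).comp ((E₁.pullback f).continuous_directSum_fst (E₂.pullback f)))
      ((Pullback.continuous_lift E₂.F E₂.E (f : B' → B)).comp ((E₁.pullback f).continuous_directSum_snd (E₂.pullback f)))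

/-- **`E₁ ≅ E₁'`, `E₂ ≅ E₂'` give `E₁ ⊕ E₂ ≅ E₁' ⊕ E₂'`.** [cite: HusemollerFibreBundles1994, Ch. 3 §2] -/
def Iso.directSumCongr {E₁ E₁' E₂ E₂' : ComplexVectorBundle.{0, 0} B} (e₁ : E₁.Iso E₁') (e₂ : E₂.Iso E₂') :
    (E₁.directSum E₂).Iso (E₁'.directSum E₂') where
  equiv b := (e₁.equiv b).prodCongr (e₂.equiv b)
  continuous_toFun := continuous_directSum_mk E₁' E₂' (fun p : TotalSpace (E₁.directSum E₂).F (E₁.directSum E₂).E ↦ p.proj)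
    (fun p ↦ e₁.equiv p.proj p.2.1) (fun p ↦ e₂.equiv p.proj p.2.2)
    (e₁.continuous_toFun.comp (E₁.continuous_directSum_fst E₂)) (e₂.continuous_toFun.comp (E₁.continuous_directSum_snd E₂))
  continuous_invFun := continuous_directSum_mk E₁ E₂ (fun p : TotalSpace (E₁'.directSum E₂').F (E₁'.directSum E₂').E ↦ p.proj)
    (fun p ↦ (e₁.equiv p.proj).symm p.2.1) (fun p ↦ (e₂.equiv p.proj).symm p.2.2)
    (e₁.continuous_invFun.comp (E₁'.continuous_directSum_fst E₂')) (e₂.continuous_invFun.comp (E₁'.continuous_directSum_snd E₂'))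

/-- **`(E₁ ⊕ E₂) ⊕ E₃ ≅ E₁ ⊕ (E₂ ⊕ E₃)`.** [cite: HusemollerFibreBundles1994, Ch. 3 §2] -/
def Iso.directSumAssoc (E₁ E₂ E₃ : ComplexVectorBundle.{0, 0} B) : ((E₁.directSum E₂).directSum E₃).Iso (E₁.directSum (E₂.directSum E₃)) where
  equiv b := ContinuousLinearEquiv.prodAssoc ℂ (E₁.E b) (E₂.E b) (E₃.E b)
  continuous_toFun := by
    refine continuous_directSum_mk E₁ (E₂.directSum E₃) (fun p : TotalSpace ((E₁.directSum E₂).directSum E₃).F ((E₁.directSum E₂).directSum E₃).E ↦ p.proj)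
      (fun p ↦ p.2.1.1) (fun p ↦ (p.2.1.2, p.2.2)) ?_ ?_
    · exact (E₁.continuous_directSum_fst E₂).comp ((E₁.directSum E₂).continuous_directSum_fst E₃)
    · exact continuous_directSum_mk E₂ E₃ (fun p : TotalSpace ((E₁.directSum E₂).directSum E₃).F ((E₁.directSum E₂).directSum E₃).E ↦ p.proj)
        (fun p ↦ p.2.1.2) (fun p ↦ p.2.2)
        ((E₁.continuous_directSum_snd E₂).comp ((E₁.directSum E₂).continuous_directSum_fst E₃)) ((E₁.directSum E₂).continuous_directSum_snd E₃)
  continuous_invFun := by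
    refine continuous_directSum_mk (E₁.directSum E₂) E₃ (fun p : TotalSpace (E₁.directSum (E₂.directSum E₃)).F (E₁.directSum (E₂.directSum E₃)).E ↦ p.proj)
      (fun p ↦ (p.2.1, p.2.2.1)) (fun p ↦ p.2.2.2) ?_ ?_
    · exact continuous_directSum_mk E₁ E₂ (fun p : TotalSpace (E₁.directSum (E₂.directSum E₃)).F (E₁.directSum (E₂.directSum E₃)).E ↦ p.proj)
        (fun p ↦ p.2.1) (fun p ↦ p.2.2.1) (E₁.continuous_directSum_fst (E₂.directSum E₃))
        ((E₂.continuous_directSum_fst E₃).comp (E₁.continuous_directSum_snd (E₂.directSum E₃)))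
    · exact (E₂.continuous_directSum_snd E₃).comp (E₁.continuous_directSum_snd (E₂.directSum E₃))

/-- **`E₁ ⊕ E₂ ≅ E₂` for `rank E₁ = 0`.** [folklore] -/
def Iso.zeroDirectSum (E₁ E₂ : ComplexVectorBundle.{0, 0} B) (h : E₁.rank = 0) : (E₁.directSum E₂).Iso E₂ where
  equiv _ :=
    { toFun := fun v ↦ v.2
      invFun := fun w ↦ (0, w)
      map_add' := fun _ _ ↦ rfl
      map_smul' := fun _ _ ↦ rfl
      left_inv := fun _ ↦ Prod.ext (E₁.fiber_eq_zero_of_rank_eq_zero h _).symm rfl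
      right_inv := fun _ ↦ rfl
      continuous_toFun := continuous_snd
      continuous_invFun := continuous_const.prodMk continuous_id }
  continuous_toFun := E₁.continuous_directSum_snd E₂
  continuous_invFun := continuous_directSum_mk E₁ E₂ (fun p : TotalSpace E₂.F E₂.E ↦ p.proj) (fun _ ↦ 0) (fun p ↦ p.2)
    ((Trivialization.continuous_zeroSection ℂ (F := E₁.F) (E := E₁.E)).comp (FiberBundle.continuous_proj E₂.F E₂.E)) continuous_id

end Isos

/-! ### The Whitney sum formula -/

section Whitney

variable (R : Type) [CommRing R]

/-- The classes of a rank-`0` bundle: `(1, 0, 0, …)`. [folklore] -/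
theorem chernClassR_unit {B : Type} [TopologicalSpace B] [T2Space B] [ParacompactSpace B] (E : ComplexVectorBundle.{0, 0} B)
    (h : E.rank = 0) : (E.chernClassR R 0 = singularCohomology.one R B) ∧ ∀ i, i ≠ 0 → E.chernClassR R i = 0 :=
  ⟨E.chernClassR_zero R, fun _ hi ↦ E.chernClassR_of_rank_eq_zero R h hi⟩

/-- The induction on the rank of the first summand. [cite: HusemollerFibreBundles1994, Ch. 17 §6 Thm. 6.2] -/
theorem chernClassR_directSum_aux : ∀ (n : ℕ) {B : Type} [TopologicalSpace B] [T2Space B] [ParacompactSpace B]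
    (E₁ E₂ : ComplexVectorBundle.{0, 0} B), E₁.rank = n → ∀ m, (E₁.directSum E₂).chernClassR R m = totMul (E₁.chernClassR R) (E₂.chernClassR R) m
  | 0, B, _, _, _, E₁, E₂, h, m => by
    rw [chernClassR_congr R (Iso.zeroDirectSum E₁ E₂ h) m,
      totMul_unit_left _ _ (E₁.chernClassR_unit R h).1 (E₁.chernClassR_unit R h).2]
  | n + 1, B, _, _, _, E₁, E₂, h, m => by
    have h₁ : 0 < E₁.rank := by omega
    -- the splitting over `P(E₁)`
    obtain ⟨g⟩ := exists_gaussMap (𝕜 := ℂ) (F := E₁.F) (E := E₁.E) (id : B × Fin (Module.finrank ℂ E₁.F) → B × Fin (Module.finrank ℂ E₁.F)) injective_id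
    let q : C(E₁.Proj, B) := E₁.projMap
    let Λ : ComplexVectorBundle E₁.Proj := E₁.lineBundle (E₁.k0 h₁)
    let Q : ComplexVectorBundle E₁.Proj := E₁.quotBundle (E₁.k0 h₁)
    have hΛ : Λ.rank = 1 := E₁.rank_lineBundle _
    have hQ : Q.rank = n := by
      have := E₁.rank_quotBundle (E₁.k0 h₁)
      change Q.rank = _ at this
      omega
    have eS : (E₁.pullback q).Iso (Λ.directSum Q) := E₁.splitIso (E₁.k0 h₁) g
    -- `q^*(E₁ ⊕ E₂) ≅ Λ ⊕ (Q ⊕ q^*E₂)`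
    have e3 : ((E₁.directSum E₂).pullback q).Iso (Λ.directSum (Q.directSum (E₂.pullback q))) :=
      ((Iso.pullbackDirectSum E₁ E₂ q).trans (Iso.directSumCongr eS (Iso.refl _))).trans (Iso.directSumAssoc Λ Q (E₂.pullback q))
    -- the left-hand side pulled back
    have hL : singularCohomology.map R R q (2 * m) ((E₁.directSum E₂).chernClassR R m) =
        whitneyLine R (Λ.eL R hΛ 1) (totMul (Q.chernClassR R) ((E₂.pullback q).chernClassR R)) m := by
      rw [← chernClassR_pullback, chernClassR_congr R e3 m, Λ.chernClassR_lineSum (Q.directSum (E₂.pullback q)) R hΛ]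
      congr 1
      funext i
      exact chernClassR_directSum_aux n Q (E₂.pullback q) hQ i
    -- the right-hand side pulled back
    have hR : singularCohomology.map R R q (2 * m) (totMul (E₁.chernClassR R) (E₂.chernClassR R) m) =
        totMul (whitneyLine R (Λ.eL R hΛ 1) (Q.chernClassR R)) ((E₂.pullback q).chernClassR R) m := by
      rw [map_totMul]
      have h1 : (fun i ↦ singularCohomology.map R R q (2 * i) (E₁.chernClassR R i)) = whitneyLine R (Λ.eL R hΛ 1) (Q.chernClassR R) := by
        funext i
        rw [← chernClassR_pullback, chernClassR_congr R eS i, Λ.chernClassR_lineSum Q R hΛ]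
      have h2 : (fun i ↦ singularCohomology.map R R q (2 * i) (E₂.chernClassR R i)) = (E₂.pullback q).chernClassR R := by
        funext i
        rw [← chernClassR_pullback]
      rw [h1, h2]
    -- the algebra of the Whitney family
    have hW : ∀ m, whitneyLine R (Λ.eL R hΛ 1) (totMul (Q.chernClassR R) ((E₂.pullback q).chernClassR R)) m =
        totMul (whitneyLine R (Λ.eL R hΛ 1) (Q.chernClassR R)) ((E₂.pullback q).chernClassR R) m := by
      intro m
      rcases m with _ | m
      · rw [whitneyLine_zero, totMul_zero _ _ (whitneyLine_zero R _ _) ((E₂.pullback q).chernClassR_zero R)]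
      · rw [whitneyLine_succ, totMul_whitneyLine _ _ _ (Q.chernClassR_zero R)]
    apply E₁.map_projMap_injective (E₁.k0 h₁) R (2 * m)
    rw [hL, hR, hW]

/-- **The Whitney sum formula (C₂): `c_m(E₁ ⊕ E₂) = Σ_{i+j=m} cᵢ(E₁) ⌣ cⱼ(E₂)`** for complex vector
bundles over a paracompact Hausdorff base (Husemoller Thm. 6.2, via the splitting principle and the
line case). [cite: HusemollerFibreBundles1994, Ch. 17 §6 Thm. 6.2] -/
theorem chernClassR_directSum {B : Type} [TopologicalSpace B] [T2Space B] [ParacompactSpace B] (E₁ E₂ : ComplexVectorBundle.{0, 0} B) (m : ℕ) :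
    (E₁.directSum E₂).chernClassR R m = ∑ ij : Finset.antidiagonal m,
      cupEven (Finset.mem_antidiagonal.mp ij.2) (E₁.chernClassR R ij.1.1) (E₂.chernClassR R ij.1.2) :=
  chernClassR_directSum_aux R E₁.rank E₁ E₂ rfl m

end Whitney

end ComplexVectorBundle

end Literature.AlgebraicTopology.CharacteristicClasses
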